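import Summits.CriticalPhenomena.PercolationContinuityZ3.Theorems.PercNearOneGluingNoHeavyLowerTailSahiCTCLadderShapesB
import Summits.CriticalPhenomena.PercolationContinuityZ3.Theorems.PercNearOneGluingNoHeavyLowerTailSahiCTCLadderNested
import HarnessLib

/-!
# `NoHeavyLowerTail` (crux stmt-CriticalPhenomena-4575), P3 lane: THE LADDER FORM `L₂ ∈ ℕ[s]` FOR EVERY PAIR OF 2-LIVE UP-SETS (memo g24 §5.5, memo g25)

Support file (seat `prim-l12-p3`, gen 25; `--supports stmt-CriticalPhenomena-4575`).  **`coeff_ladder_two_nonneg`**: for up-sets `𝒳, 𝒵 ⊆ 2^α` all of whose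
members have ≥ 2 elements, every coefficient of
    `L₂(𝒳,𝒵) = e₂·(Π·GF(𝒳∩𝒵) − GF(𝒳)·GF(𝒵)) − Θ₁·GF({S : 2 ≤ #S})·GF((𝒳∩𝒵)₂)`
is nonnegative — the LADDER CONJECTURE of memo g24 §5.5 (the statement of `…SahiCTCLadderNested.coeff_ladder_two_nonneg_of_subset` without the nestedness
hypothesis; value form `Cov(𝒳,𝒵) ≥ Var(1_{≥2 open})·μ₂(common 2-sets)`, equality at `𝒳 = 𝒵 = {all sets of size ≥ 2}`).  With `…SahiCTCCoLevelTwoSplit.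
coeff_Mtwo_nonneg_of_ladder` and `…SahiCTCRPrime` this gives `M₂ ∈ ℕ[s]` for EVERY pair of up-sets, i.e. CTC at co-level 2 for every k, and through
`…SahiCTCLevelDuality` / `…SahiAtLeastTwoRowA` Kahn C5 / Sahi C₃ for the slot "at least two of k open" (those corollaries are stated in their own file once
the gen-24 chain has landed).  This file: the shapes with a tripled point (`row_M`, `shape_M_zero`, `shape_M_one`) and the case analysis on the shape of the
profile (`coeff_ladder_two_nonneg`, `coeff_ladder_two_nonneg_PiP`).  Proof: memo `run/shared/lean/prim/prim-l12/FROM-prim-l12-p3-g25-LADDER-L2-PROOF.md`.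
Nothing is asserted about the crux.
-/

namespace Summit.CriticalPhenomena.PercolationContinuityZ3.Theorems.SahiCTCForms

open Finset MvPolynomial SahiCTCGenFun

variable {α : Type*} [DecidableEq α] [Fintype α]

section ShapesM
variable {𝒳 𝒵 : Finset (Finset α)} {m : α →₀ ℕ}

omit [Fintype α] in
/-- Row (i) in Kleitman-surplus form: `[2 ≤ t]·#N(x) ≤ Σ_{y ∈ T} κ({x}, T − y)`. [this work] -/
theorem row_M (h𝒳 : IsUpperSet (𝒳 : Set (Finset α))) (h𝒵 : IsUpperSet (𝒵 : Set (Finset α)))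
    (hX2 : ∀ U ∈ 𝒳, 2 ≤ #U) (hZ2 : ∀ U ∈ 𝒵, 2 ≤ #U) {x : α} {T : Finset α} (hxT : x ∉ T) :
    (if 2 ≤ #T then (#(cnbrs 𝒳 𝒵 (insert x T) x) : ℤ) else 0) ≤ ∑ y ∈ T, kap 𝒳 𝒵 {x} (T.erase y) := by
  have hxX : ({x} : Finset α) ∉ 𝒳 := fun h => by have := hX2 _ h; simp at this
  have hxZ : ({x} : Finset α) ∉ 𝒵 := fun h => by have := hZ2 _ h; simp at this
  have hNT : cnbrs 𝒳 𝒵 (insert x T) x ⊆ T := fun y hy => ((mem_cnbrs_insert hxT).1 hy).1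
  have h0 : ∀ y ∈ T, 0 ≤ kap 𝒳 𝒵 {x} (T.erase y) := fun y hy =>
    kap_nonneg h𝒳 h𝒵 _ _ (by rw [disjoint_singleton_left]; exact fun h => hxT (mem_of_mem_erase h))
  split_ifs with h2
  swap
  · exact sum_nonneg h0
  by_cases hN0 : cnbrs 𝒳 𝒵 (insert x T) x = ∅
  · rw [hN0, card_empty, Nat.cast_zero]; exact sum_nonneg h0
  obtain ⟨n, hn⟩ := nonempty_iff_ne_empty.2 hN0
  have hb := card_sub_le_sum (S := T) (X := if 2 ≤ #(cnbrs 𝒳 𝒵 (insert x T) x) then ∅ else {n})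
    (f := fun y => kap 𝒳 𝒵 {x} (T.erase y)) h0 (fun y hy hyX => by
      have : ∃ u ∈ cnbrs 𝒳 𝒵 (insert x T) x, u ≠ y := by
        split_ifs at hyX with hc
        · obtain ⟨u, u', hu, hu', huu'⟩ := one_lt_card_iff.1 hc
          by_cases huy : u = y
          · exact ⟨u', hu', fun h => huu' (huy.trans h.symm)⟩
          · exact ⟨u, hu, huy⟩
        · rw [mem_singleton] at hyX; exact ⟨n, hn, fun h => hyX h.symm⟩
      obtain ⟨u, hu, huy⟩ := this
      obtain ⟨huT, hX, hZ⟩ := (mem_cnbrs_insert hxT).1 hu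
      rw [pair_comm] at hX hZ
      exact one_le_kap_of_loop h𝒳 h𝒵 hxX hxZ (mem_erase.2 ⟨huy, huT⟩) hX hZ)
  beta_reduce at hb
  have hNle : (#(cnbrs 𝒳 𝒵 (insert x T) x) : ℤ) ≤ #T := by exact_mod_cast card_le_card hNT
  split_ifs at hb with hc
  · rw [card_empty, Nat.cast_zero, sub_zero] at hb; linarith
  · rw [card_singleton] at hb
    have : (#(cnbrs 𝒳 𝒵 (insert x T) x) : ℤ) ≤ 1 := by exact_mod_cast (by omega : #(cnbrs 𝒳 𝒵 (insert x T) x) ≤ 1)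
    have : (2 : ℤ) ≤ #T := by exact_mod_cast h2
    push_cast at hb; linarith

/-- **Shape (i), no doubled point**: one tripled point `x`. [this work] -/
theorem shape_M_zero (h𝒳 : IsUpperSet (𝒳 : Set (Finset α))) (h𝒵 : IsUpperSet (𝒵 : Set (Finset α)))
    (hX2 : ∀ U ∈ 𝒳, 2 ≤ #U) (hZ2 : ∀ U ∈ 𝒵, 2 ≤ #U) (h3 : ∀ i, m i ≤ 3) {x : α} (hM : lev m 3 = {x}) (hD : lev m 2 = ∅) :
    ∑ e ∈ cedges 𝒳 𝒵 m.support, ((Th1 : MvPolynomial α ℤ) * gf (bySize (2 ≤ ·) : Finset (Finset α))).coeff (m - ind e)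
      ≤ (ee 2 * (PiP * gf (𝒳 ∩ 𝒵) - gf 𝒳 * gf 𝒵)).coeff m := by
  set T := lev m 1 with hT
  have hxT : x ∉ T := fun h => by
    have := disjoint_lev (m := m) (k := 3) (k' := 1) (by norm_num) (by norm_num) (by norm_num)
    rw [hM, disjoint_singleton_left] at this; exact this h
  have hsupp : m.support = insert x T := by rw [support_eq_lev_union h3, hM, hD, union_empty, ← hT, ← insert_eq]
  rw [hsupp, sum_cedges_insert hxT]
  -- charges: pairs {x,y} at most [2 ≤ t], pairs inside T nothing
  have h1 : ∀ y ∈ cnbrs 𝒳 𝒵 (insert x T) x,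
      ((Th1 : MvPolynomial α ℤ) * gf (bySize (2 ≤ ·) : Finset (Finset α))).coeff (m - ind {x, y}) ≤ (if 2 ≤ #T then 1 else 0) :=
    fun y hy => by
    have hyT := ((mem_cnbrs_insert hxT).1 hy).1
    have hMe : lev m 3 ⊆ {x, y} := by rw [hM]; exact singleton_subset_iff.2 (by simp)
    have e1 : ({x} : Finset α) ∩ {x, y} = {x} := inter_eq_left.2 (singleton_subset_iff.2 (by simp))
    have e3 : T \ {x, y} = T.erase y := by
      ext z; simp only [mem_sdiff, mem_insert, mem_singleton, mem_erase, not_or]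
      exact ⟨fun ⟨h1, _, h3⟩ => ⟨h3, h1⟩, fun ⟨h1, h2⟩ => ⟨h2, fun h => hxT (h ▸ h2), h1⟩⟩
    have h := charge_le_one h3 hMe (by rw [hM, hD, e1, empty_sdiff, union_empty, card_singleton])
    rw [hD, empty_inter, empty_union, ← hT, e3, card_erase_of_mem hyT] at h
    refine h.trans ?_
    have := card_pos.2 ⟨y, hyT⟩
    by_cases h2 : 2 ≤ #T
    · rw [if_pos h2, if_pos (by omega)]
    · rw [if_neg h2, if_neg (by omega)]
  have h2 : ∀ e ∈ cedges 𝒳 𝒵 T, ((Th1 : MvPolynomial α ℤ) * gf (bySize (2 ≤ ·) : Finset (Finset α))).coeff (m - ind e) = 0 :=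
    fun e he => charge_eq_zero_of_not_subset h3 (by
      rw [hM, singleton_subset_iff]; exact fun h => hxT ((mem_cedges.1 he).1 h))
  rw [sum_congr rfl h2, sum_const_zero, add_zero]
  have hB := sum_le_sum h1
  rw [sum_const, nsmul_eq_mul] at hB
  -- surplus
  have hA := row_M h𝒳 h𝒵 hX2 hZ2 (𝒳 := 𝒳) (𝒵 := 𝒵) hxT
  have hadm : T.image (fun y => ({x, y} : Finset α)) ⊆ (bySize (· = 2) : Finset (Finset α)).filter fun E => ind E ≤ m :=
    fun E hE => by
      obtain ⟨y, hy, rfl⟩ := mem_image.1 hE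
      exact pair_mem_admissible (fun h => hxT (h ▸ hy)) (by rw [hsupp]; simp) (by rw [hsupp]; simp [hy])
  have hS := sum_le_coeff_ee_two_mul_harris h𝒳 h𝒵 m hadm
  rw [sum_image (injOn_pair x hxT)] at hS
  have heq : ∀ y ∈ T, (PiP * gf (𝒳 ∩ 𝒵) - gf 𝒳 * gf 𝒵).coeff (m - ind {x, y}) = kap 𝒳 𝒵 {x} (T.erase y) := fun y hy => by
    have hMe : lev m 3 ⊆ {x, y} := by rw [hM]; exact singleton_subset_iff.2 (by simp)
    rw [coeff_harris_residual h3 hMe, hM, hD, inter_eq_left.2 (singleton_subset_iff.2 (by simp : x ∈ ({x, y} : Finset α))),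
      empty_sdiff, union_empty, empty_inter, empty_union, ← hT]
    congr 1
    ext z; simp only [mem_sdiff, mem_insert, mem_singleton, mem_erase, not_or]
    exact ⟨fun ⟨h1, _, h3⟩ => ⟨h3, h1⟩, fun ⟨h1, h2⟩ => ⟨h2, fun h => hxT (h ▸ h2), h1⟩⟩
  rw [sum_congr rfl heq] at hS
  have hN0 : (0 : ℤ) ≤ #(cnbrs 𝒳 𝒵 (insert x T) x) := Nat.cast_nonneg _
  by_cases h2T : 2 ≤ #T
  · rw [if_pos h2T] at hA hB; linarith
  · rw [if_neg h2T] at hA hB; linarith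

/-- **Shape (i), one doubled point `y₀`**: one tripled point `x`. [this work] -/
theorem shape_M_one (h𝒳 : IsUpperSet (𝒳 : Set (Finset α))) (h𝒵 : IsUpperSet (𝒵 : Set (Finset α)))
    (hX2 : ∀ U ∈ 𝒳, 2 ≤ #U) (hZ2 : ∀ U ∈ 𝒵, 2 ≤ #U) (h3 : ∀ i, m i ≤ 3) {x y₀ : α} (hM : lev m 3 = {x})
    (hD : lev m 2 = {y₀}) :
    ∑ e ∈ cedges 𝒳 𝒵 m.support, ((Th1 : MvPolynomial α ℤ) * gf (bySize (2 ≤ ·) : Finset (Finset α))).coeff (m - ind e)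
      ≤ (ee 2 * (PiP * gf (𝒳 ∩ 𝒵) - gf 𝒳 * gf 𝒵)).coeff m := by
  set T := lev m 1 with hT
  have hxy : x ≠ y₀ := fun h => by
    have := disjoint_lev (m := m) (k := 3) (k' := 2) (by norm_num) (by norm_num) (by norm_num)
    rw [hM, hD, disjoint_singleton_left, mem_singleton] at this; exact this h
  have hxT : x ∉ T := fun h => by
    have := disjoint_lev (m := m) (k := 3) (k' := 1) (by norm_num) (by norm_num) (by norm_num)
    rw [hM, disjoint_singleton_left] at this; exact this h
  have hyT : y₀ ∉ T := fun h => by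
    have := disjoint_lev (m := m) (k := 2) (k' := 1) (by norm_num) (by norm_num) (by norm_num)
    rw [hD, disjoint_singleton_left] at this; exact this h
  have hsupp : m.support = insert x (insert y₀ T) := by
    rw [support_eq_lev_union h3, hM, hD, ← hT, ← insert_eq, insert_union, ← insert_eq]
  -- every charge other than at e = {x, y₀} vanishes, and that one is ≤ 1
  have hterm : ∀ e ∈ cedges 𝒳 𝒵 m.support,
      ((Th1 : MvPolynomial α ℤ) * gf (bySize (2 ≤ ·) : Finset (Finset α))).coeff (m - ind e)
        ≤ if e = {x, y₀} then 1 else 0 := fun e he => by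
    obtain ⟨heS, he2, -, -⟩ := mem_cedges.1 he
    split_ifs with hexy
    · subst hexy
      have hMe : lev m 3 ⊆ {x, y₀} := by rw [hM]; exact singleton_subset_iff.2 (by simp)
      refine (charge_le_one h3 hMe ?_).trans (by split_ifs <;> norm_num)
      rw [hM, hD, inter_eq_left.2 (singleton_subset_iff.2 (by simp : x ∈ ({x, y₀} : Finset α))),
        sdiff_eq_empty_iff_subset.2 (singleton_subset_iff.2 (by simp : y₀ ∈ ({x, y₀} : Finset α))), union_empty, card_singleton]
    · by_cases hxe : x ∈ e
      · have hMe : lev m 3 ⊆ e := by rw [hM]; exact singleton_subset_iff.2 hxe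
        refine le_of_eq (charge_eq_zero_of_two_le h3 hMe ?_)
        rw [hM, hD, inter_eq_left.2 (singleton_subset_iff.2 hxe)]
        have hye : y₀ ∉ e := fun h => by
          apply hexy
          refine (eq_of_subset_of_card_le (insert_subset hxe (singleton_subset_iff.2 h)) ?_).symm
          rw [he2, card_pair hxy]
        rw [sdiff_eq_self_of_disjoint (disjoint_singleton_left.2 hye), card_union_of_disjoint (by simp [hxy]), card_singleton,
          card_singleton]
      · exact le_of_eq (charge_eq_zero_of_not_subset h3 (by rw [hM, singleton_subset_iff]; exact hxe))
  have hB : ∑ e ∈ cedges 𝒳 𝒵 m.support, ((Th1 : MvPolynomial α ℤ) * gf (bySize (2 ≤ ·) : Finset (Finset α))).coeff (m - ind e)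
      ≤ if ({x, y₀} : Finset α) ∈ 𝒳 ∧ ({x, y₀} : Finset α) ∈ 𝒵 then 1 else 0 := by
    refine (sum_le_sum hterm).trans ?_
    rw [sum_boole]
    split_ifs with hc
    · have : (cedges 𝒳 𝒵 m.support).filter (fun e => e = {x, y₀}) ⊆ {({x, y₀} : Finset α)} := fun e he => by
        rw [mem_singleton]; exact (mem_filter.1 he).2
      exact_mod_cast (card_le_card this).trans (card_singleton _).le
    · have : (cedges 𝒳 𝒵 m.support).filter (fun e => e = {x, y₀}) = ∅ :=
        filter_eq_empty_iff.2 fun e he h => by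
          subst h; obtain ⟨_, _, hX, hZ⟩ := mem_cedges.1 he; exact hc ⟨hX, hZ⟩
      rw [this, card_empty]; norm_num
  -- surplus
  have hS := sum_le_coeff_ee_two_mul_harris h𝒳 h𝒵 m (S := {({x, y₀} : Finset α)})
    (singleton_subset_iff.2 (pair_mem_admissible hxy (by rw [hsupp]; simp) (by rw [hsupp]; simp)))
  rw [sum_singleton] at hS
  have hMe : lev m 3 ⊆ {x, y₀} := by rw [hM]; exact singleton_subset_iff.2 (by simp)
  rw [coeff_harris_residual h3 hMe, hM, hD, inter_eq_left.2 (singleton_subset_iff.2 (by simp : x ∈ ({x, y₀} : Finset α))),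
    sdiff_eq_empty_iff_subset.2 (singleton_subset_iff.2 (by simp : y₀ ∈ ({x, y₀} : Finset α))), union_empty,
    inter_eq_left.2 (singleton_subset_iff.2 (by simp : y₀ ∈ ({x, y₀} : Finset α))), ← hT,
    sdiff_eq_self_of_disjoint (Finset.disjoint_left.2 fun z hz h => by
      simp only [mem_insert, mem_singleton] at h
      rcases h with rfl | rfl; exact hxT hz; exact hyT hz), ← insert_eq] at hS
  refine hB.trans (le_trans ?_ hS)
  split_ifs with hc
  · have hxX : ({x} : Finset α) ∉ 𝒳 := fun h => by have := hX2 _ h; simp at this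
    have hxZ : ({x} : Finset α) ∉ 𝒵 := fun h => by have := hZ2 _ h; simp at this
    have h1 := hc.1; have h2 := hc.2
    rw [pair_comm] at h1 h2
    exact one_le_kap_of_loop h𝒳 h𝒵 hxX hxZ (mem_insert_self y₀ T) h1 h2
  · exact kap_nonneg h𝒳 h𝒵 _ _ (by
      rw [disjoint_singleton_left, mem_insert, not_or]; exact ⟨hxy, hxT⟩)

end ShapesM

section Main
variable {𝒳 𝒵 : Finset (Finset α)}

/-- **THE LADDER FORM `L₂ ∈ ℕ[s]` (memo g24 §5.5, proved in memo g25): for up-sets `𝒳, 𝒵 ⊆ 2^α` all of whose members have ≥ 2 elements,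
every coefficient of `e₂·(Π·GF(𝒳∩𝒵) − GF(𝒳)·GF(𝒵)) − Θ₁·GF({S : 2 ≤ #S})·GF((𝒳∩𝒵)₂)` is nonnegative** — the statement of
`…SahiCTCLadderNested.coeff_ladder_two_nonneg_of_subset` WITHOUT the nestedness hypothesis.  Value form: `Cov(𝒳,𝒵) ≥ Var(1_{≥2 open})·μ₂(W₂)`.
[this work] -/
theorem coeff_ladder_two_nonneg (h𝒳 : IsUpperSet (𝒳 : Set (Finset α))) (h𝒵 : IsUpperSet (𝒵 : Set (Finset α)))
    (hX2 : ∀ S ∈ 𝒳, 2 ≤ #S) (hZ2 : ∀ S ∈ 𝒵, 2 ≤ #S) (m : α →₀ ℕ) :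
    0 ≤ (ee 2 * (PiP * gf (𝒳 ∩ 𝒵) - gf 𝒳 * gf 𝒵) -
      Th1 * gf (bySize (2 ≤ ·) : Finset (Finset α)) * gf ((𝒳 ∩ 𝒵).filter fun S => #S = 2)).coeff m := by
  rw [coeff_sub, sub_nonneg, coeff_charge_eq_sum, filter_W_eq_cedges]
  by_cases h4 : ∃ i, 4 ≤ m i
  · obtain ⟨i, hi⟩ := h4
    refine shape_zero h𝒳 h𝒵 fun e _ => coeff_Th1_mul_atLeastTwo_eq_zero fun hle => ?_
    have := hle i; rw [SahiAllButC.tsub_ind_apply] at this; split_ifs at this <;> omega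
  have h3 : ∀ i, m i ≤ 3 := fun i => by by_contra h; exact h4 ⟨i, by omega⟩
  rcases Nat.lt_or_ge 1 (#(lev m 3)) with hM2 | hM1
  · -- two or more tripled points: every charge vanishes
    refine shape_zero h𝒳 h𝒵 fun e _ => ?_
    by_cases hMe : lev m 3 ⊆ e
    · refine charge_eq_zero_of_two_le h3 hMe ?_
      rw [inter_eq_left.2 hMe]; exact le_trans hM2 (card_le_card subset_union_left)
    · exact charge_eq_zero_of_not_subset h3 hMe
  by_cases hM0 : #(lev m 3) = 1
  · obtain ⟨x, hM⟩ := card_eq_one.1 hM0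
    rcases Nat.lt_or_ge 1 (#(lev m 2)) with hD2 | hD1
    · -- one tripled point, ≥ 2 doubled points: every charge vanishes
      refine shape_zero h𝒳 h𝒵 fun e he => ?_
      obtain ⟨_, he2, -, -⟩ := mem_cedges.1 he
      by_cases hMe : lev m 3 ⊆ e
      · refine charge_eq_zero_of_two_le h3 hMe ?_
        rw [inter_eq_left.2 hMe, hM]
        have hxe : x ∈ e := hMe (by rw [hM]; exact mem_singleton_self x)
        have hxD : x ∉ lev m 2 := fun h => by
          have := disjoint_lev (m := m) (k := 3) (k' := 2) (by norm_num) (by norm_num) (by norm_num)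
          rw [hM, disjoint_singleton_left] at this; exact this h
        -- #(D \\ e) ≥ #D − 1 ≥ 1 and x ∉ D \\ e
        have hDe : #(lev m 2 ∩ e) ≤ 1 := by
          have : lev m 2 ∩ e ⊆ e.erase x := fun z hz => mem_erase.2 ⟨fun h => hxD (h ▸ (mem_inter.1 hz).1), (mem_inter.1 hz).2⟩
          have := card_le_card this; rw [card_erase_of_mem hxe, he2] at this; exact this
        have h1 := card_sdiff_add_card_inter (lev m 2) e
        rw [card_union_of_disjoint (disjoint_singleton_left.2 fun h => hxD (mem_sdiff.1 h).1), card_singleton]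
        omega
      · exact charge_eq_zero_of_not_subset h3 hMe
    by_cases hD0 : #(lev m 2) = 1
    · obtain ⟨y₀, hD⟩ := card_eq_one.1 hD0
      exact shape_M_one h𝒳 h𝒵 hX2 hZ2 h3 hM hD
    · exact shape_M_zero h𝒳 h𝒵 hX2 hZ2 h3 hM (card_eq_zero.1 (by omega))
  have hM : lev m 3 = ∅ := card_eq_zero.1 (by omega)
  -- no tripled point: shapes by the number of doubled points
  rcases Nat.lt_or_ge 3 (#(lev m 2)) with hD4 | hD3
  · refine shape_zero h𝒳 h𝒵 fun e he => ?_
    obtain ⟨_, he2, -, -⟩ := mem_cedges.1 he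
    refine charge_eq_zero_of_two_le h3 (by rw [hM]; exact empty_subset e) ?_
    rw [hM, empty_inter, empty_union]
    have h1 := card_sdiff_add_card_inter (lev m 2) e
    have : #(lev m 2 ∩ e) ≤ 2 := by have := card_le_card (inter_subset_right : lev m 2 ∩ e ⊆ e); rw [he2] at this; exact this
    omega
  by_cases hD3' : #(lev m 2) = 3
  · exact shape_three h𝒳 h𝒵 hX2 hZ2 h3 hM hD3'
  by_cases hD2 : #(lev m 2) = 2
  · obtain ⟨a, b, hab, hD⟩ := card_eq_two.1 hD2
    exact shape_two h𝒳 h𝒵 hX2 hZ2 h3 hM hab hD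
  by_cases hD1 : #(lev m 2) = 1
  · obtain ⟨d, hD⟩ := card_eq_one.1 hD1
    exact shape_one h𝒳 h𝒵 hX2 hZ2 h3 hM hD
  exact shape_sqfree h𝒳 h𝒵 hX2 hZ2 h3 hM (card_eq_zero.1 (by omega))

/-- The same with `e_{≥2}` written as `Π − Θ₁` (the form of `…SahiCTCLadderNested.coeff_ladder_two_nonneg_of_subset_PiP`). [this work] -/
theorem coeff_ladder_two_nonneg_PiP (h𝒳 : IsUpperSet (𝒳 : Set (Finset α))) (h𝒵 : IsUpperSet (𝒵 : Set (Finset α)))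
    (hX2 : ∀ S ∈ 𝒳, 2 ≤ #S) (hZ2 : ∀ S ∈ 𝒵, 2 ≤ #S) (m : α →₀ ℕ) :
    0 ≤ (ee 2 * (PiP * gf (𝒳 ∩ 𝒵) - gf 𝒳 * gf 𝒵) -
      Th1 * (PiP - Th1) * gf ((𝒳 ∩ 𝒵).filter fun S => #S = 2)).coeff m := by
  have h : (PiP : MvPolynomial α ℤ) - Th1 = gf (bySize (2 ≤ ·) : Finset (Finset α)) := by
    rw [PiP_eq_Th1_add_gf_atLeastTwo]; ring
  rw [h]; exact coeff_ladder_two_nonneg h𝒳 h𝒵 hX2 hZ2 m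

end Main

end Summit.CriticalPhenomena.PercolationContinuityZ3.Theorems.SahiCTCForms
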